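import Summits.KontsevichZagierPeriods.KontsevichZagierPeriods.Theorems.FiveTermTransfer.Negative.LoadBearing

/-!
# `FiveTermTransfer` (stmt-KontsevichZagierPeriods-3469) — negative knowledge, part 2: both algebraicity hypotheses are load-bearing

Off the algebraic upper half plane the crux does not constrain `ρ`, so a transcendental `x` or `y`
hands the statement junk representations. Witnesses: `x = L + i`, `y = 2`, resp. `x = −1`,
`y = L + i`, with `L = Σ 2^{-k!}` Liouville's constant (`transcendental_liouvilleNumber`) and the
junk family `J₁ w = −R₀` on the line `Im w = 1`, `R₀` elsewhere, arranged so that every term of the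
value has the same sign whatever the (unknown) algebraicity status of the derived arguments.
(cdisprove seat gen 2; work file `Cruxes/FiveTermTransfer/Disproof.lean`.) [folklore]
-/

noncomputable section

open Complex MeasureTheory Set
open scoped ComplexConjugate

namespace Summit.KontsevichZagierPeriods.HyperbolicBloch.FiveTermTransferNegative

open Literature.NumberTheory.Transcendental
open Literature.NumberTheory.Transcendental.KZ
open Summit.KontsevichZagierPeriods.KontsevichZagierPeriods.Theses.HyperbolicBloch (FiveTermTransfer)

/-! ### Algebraicity of `x` and of `y`

Off the algebraic upper half plane `ρ` is unconstrained, so a transcendental `x` (or `y`) hands the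
statement junk representations. The witnesses use `L + i` with `L = Σ 2^{-k!}` Liouville's constant
(`transcendental_liouvilleNumber`), `y = 2` (resp. `x = −1`), and the junk family
`J₁ w = −R₀` if `Im w = 1`, `R₀` otherwise, arranged so that every term of the value has the same
sign whatever the (unknown) algebraicity status of the three derived arguments. -/

/-- Liouville's constant `L = Σ_{k ≥ 0} 2^{-k!}`. -/
def L : ℝ := liouvilleNumber 2

/-- Auxiliary: `not_isAlgebraic_L`. [folklore] -/
theorem not_isAlgebraic_L : ¬ IsAlgebraic ℚ L := fun h =>
  transcendental_liouvilleNumber (m := 2) le_rfl ((IsFractionRing.isAlgebraic_iff ℤ ℚ ℝ).mpr h)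

/-- Auxiliary: `L_mul_L_ne_one`. [folklore] -/
theorem L_mul_L_ne_one : L * L ≠ 1 := by
  intro h
  rcases mul_self_eq_one_iff.mp h with h1 | h1
  · exact not_isAlgebraic_L (h1 ▸ isAlgebraic_one)
  · exact not_isAlgebraic_L (h1 ▸ isAlgebraic_one.neg)

/-- Auxiliary: `L_ne_zero`. [folklore] -/
theorem L_ne_zero : L ≠ 0 := fun h => not_isAlgebraic_L (h ▸ isAlgebraic_zero)

/-- Auxiliary: `L_ne_two`. [folklore] -/
theorem L_ne_two : L ≠ 2 := by
  intro h
  apply not_isAlgebraic_L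
  rw [h]
  exact_mod_cast isAlgebraic_algebraMap (R := ℚ) (A := ℝ) (2 : ℚ)

/-- The transcendental point `L + i` of the upper half plane. -/
def xL : ℂ := (L : ℂ) + I

/-- Auxiliary: `xL_re`. [folklore] -/
@[simp] theorem xL_re : xL.re = L := by simp [xL]
/-- Auxiliary: `xL_im`. [folklore] -/
@[simp] theorem xL_im : xL.im = 1 := by simp [xL]

/-- Auxiliary: `not_isAlgebraic_xL`. [folklore] -/
theorem not_isAlgebraic_xL : ¬ IsAlgebraic ℚ xL := fun h =>
  not_isAlgebraic_L (by simpa using (isAlgebraic_re_im h).1)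

/-- Auxiliary: `xL_ne_zero`. [folklore] -/
theorem xL_ne_zero : xL ≠ 0 := by intro e; simpa using congrArg Complex.im e

/-- Auxiliary: `normSq_xL`. [folklore] -/
theorem normSq_xL : Complex.normSq xL = L * L + 1 := by simp [Complex.normSq_apply, xL]

/-- Auxiliary: `normSq_xL_pos`. [folklore] -/
theorem normSq_xL_pos : 0 < L * L + 1 := add_pos_of_nonneg_of_pos (mul_self_nonneg L) one_pos

/-- The junk family: `−R₀` on the horizontal line `Im w = 1`, `R₀` elsewhere. -/
def J₁ (w : ℂ) : IntegralRep 3 :=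
  open scoped Classical in
  if w.im = 1 then R₀.neg else R₀

/-- The `ρ` used for the algebraicity witnesses. -/
abbrev ρ₁ : ℂ → IntegralRep 3 := stdRep J₁

/-- Auxiliary: `ρ₁_eq_neg`. [folklore] -/
theorem ρ₁_eq_neg {w : ℂ} (hw : ¬ IsAlgebraic ℚ w) (h1 : w.im = 1) : ρ₁ w = R₀.neg := by
  show stdRep J₁ w = R₀.neg
  rw [stdRep_of_not _ (fun h => hw h.1)]
  simp [J₁, h1]

/-- Auxiliary: `value_ρ₁_pos_of_im_ne_one`. [folklore] -/
theorem value_ρ₁_pos_of_im_ne_one {w : ℂ} (hw : w.im ≠ 1) : 0 < (ρ₁ w).value := by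
  show 0 < (stdRep J₁ w).value
  by_cases h : IsAlgebraic ℚ w ∧ 0 < w.im
  · rw [stdRep_of_pos _ h.1 h.2]
    exact value_idealTetrahedronRep_pos _ _ _
  · rw [stdRep_of_not _ h]
    simp [J₁, hw, R₀_value_pos]

/-- The crux with the hypothesis `IsAlgebraic ℚ x` deleted. -/
def FiveTermTransferWithoutAlgX : Prop :=
  ∀ (T : ℂ → Set (Fin 3 → ℝ)), (∀ z, T z = {p | 0 < p 1 ∧ z.re * p 1 < z.im * p 0 ∧ z.im * (p 0 - 1) < (z.re - 1) * p 1 ∧ 0 < p 2 ∧ 0 < z.im * (p 0 ^ 2 + p 1 ^ 2 + p 2 ^ 2 - p 0) + (z.re - Complex.normSq z) * p 1}) →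
    ∀ (ρ : ℂ → IntegralRep 3), (∀ z, IsAlgebraic ℚ z → 0 < z.im → (ρ z).domain = T z ∧ Set.EqOn (ρ z).integrand (fun p => 1 / p 2 ^ 3) (T z)) →
    ∀ (B : ℂ → FormalRep), (∀ z, B z = if 0 < z.im then KZ.of (ρ z) else if z.im < 0 then -KZ.of (ρ ((starRingEnd ℂ) z)) else 0) →
    ∀ x y : ℂ, IsAlgebraic ℚ y →
    x ≠ 0 → x ≠ 1 → y ≠ 0 → y ≠ 1 → x ≠ y →
    B x - B y + B (y / x) - B ((1 - x⁻¹) / (1 - y⁻¹)) + B ((1 - x) / (1 - y)) ∈ relations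

/-- **Algebraicity of `x` is load-bearing.** Witness `x = L + i` (transcendental), `y = 2`,
`ρ = ρ₁`: the value of the element is `−2·vol T(i) − (two positive volumes) < 0`. [folklore] -/
theorem fiveTermTransfer_false_without_algX : ¬ FiveTermTransferWithoutAlgX := by
  intro h
  have hmem := h idealTetrahedron (fun _ => rfl) ρ₁ (isStandardOn_stdRep J₁) (signedClass ρ₁)
    (fun _ => rfl) xL 2 (isAlgebraic_of_eq_rat 2 0 (by push_cast; ring)) xL_ne_zero
    (by intro e; simpa using congrArg Complex.im e) two_ne_zero (by norm_num)
    (by intro e; simpa using congrArg Complex.im e)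
  change fiveTerm (signedClass ρ₁) xL 2 ∈ relations at hmem
  -- the five arguments
  have him3 : ((2:ℂ) / xL).im < 0 := by
    have e : ((2:ℂ) / xL).im = -(2 / (L * L + 1)) := by
      rw [Complex.div_im, normSq_xL]; simp [xL]
    rw [e]
    exact neg_neg_of_pos (div_pos two_pos normSq_xL_pos)
  have him3' : (conj ((2:ℂ) / xL)).im ≠ 1 := by
    have e : (conj ((2:ℂ) / xL)).im = 2 / (L * L + 1) := by
      rw [Complex.conj_im, Complex.div_im, normSq_xL]; simp [xL]
    rw [e]
    intro e
    apply L_mul_L_ne_one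
    field_simp at e
    linarith
  have e4 : (1 - xL⁻¹) / (1 - (2:ℂ)⁻¹) = 2 - 2 * xL⁻¹ := by
    have h2 : (1 - (2:ℂ)⁻¹) = 2⁻¹ := by norm_num
    rw [h2, div_eq_iff (by norm_num)]
    ring
  have him4 : 0 < ((2:ℂ) - 2 * xL⁻¹).im ∧ ((2:ℂ) - 2 * xL⁻¹).im ≠ 1 := by
    have : ((2:ℂ) - 2 * xL⁻¹).im = 2 / (L * L + 1) := by
      simp [Complex.inv_im, normSq_xL]
      ring
    rw [this]
    refine ⟨div_pos two_pos normSq_xL_pos, fun e => L_mul_L_ne_one ?_⟩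
    field_simp at e
    linarith
  have e5 : (1 - xL) / (1 - 2) = xL - 1 := by ring
  have halg5 : ¬ IsAlgebraic ℚ (xL - 1) := fun h5 =>
    not_isAlgebraic_xL (by simpa using h5.add isAlgebraic_one)
  -- evaluate
  have key : eval (fiveTerm (signedClass ρ₁) xL 2) =
      -R₀.value - (ρ₁ (conj ((2:ℂ) / xL))).value - (ρ₁ ((2:ℂ) - 2 * xL⁻¹)).value + -R₀.value := by
    unfold fiveTerm
    rw [e4, e5, signedClass_of_im_pos ρ₁ (z := xL) (by simp), signedClass_of_im_zero ρ₁ (z := 2) (by simp),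
      signedClass_of_im_neg ρ₁ him3, signedClass_of_im_pos ρ₁ him4.1,
      signedClass_of_im_pos ρ₁ (z := xL - 1) (by simp), ρ₁_eq_neg not_isAlgebraic_xL xL_im,
      ρ₁_eq_neg halg5 (by simp)]
    simp only [map_add, map_sub, map_neg, eval_of, IntegralRep.value_neg, sub_zero]
    ring
  refine not_mem_relations_of_eval_ne_zero (ne_of_lt ?_) hmem
  rw [key]
  linarith [R₀_value_pos, value_ρ₁_pos_of_im_ne_one him3', value_ρ₁_pos_of_im_ne_one him4.2]


/-- Auxiliary: `xL_ne_one`. [folklore] -/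
theorem xL_ne_one : xL ≠ 1 := by intro e; simpa using congrArg Complex.im e

/-- `(L − 1)² + 1 ≠ 2`, i.e. `L ∉ {0, 2}` (both rational). -/
theorem normSq_xL_sub_one_ne_two : (L - 1) * (L - 1) + 1 ≠ 2 := by
  intro h
  have h' : L * (L - 2) = 0 := by linear_combination h
  rcases mul_eq_zero.mp h' with h0 | h2
  · exact L_ne_zero h0
  · exact L_ne_two (sub_eq_zero.mp h2)

/-- The crux with the hypothesis `IsAlgebraic ℚ y` deleted. -/
def FiveTermTransferWithoutAlgY : Prop :=
  ∀ (T : ℂ → Set (Fin 3 → ℝ)), (∀ z, T z = {p | 0 < p 1 ∧ z.re * p 1 < z.im * p 0 ∧ z.im * (p 0 - 1) < (z.re - 1) * p 1 ∧ 0 < p 2 ∧ 0 < z.im * (p 0 ^ 2 + p 1 ^ 2 + p 2 ^ 2 - p 0) + (z.re - Complex.normSq z) * p 1}) →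
    ∀ (ρ : ℂ → IntegralRep 3), (∀ z, IsAlgebraic ℚ z → 0 < z.im → (ρ z).domain = T z ∧ Set.EqOn (ρ z).integrand (fun p => 1 / p 2 ^ 3) (T z)) →
    ∀ (B : ℂ → FormalRep), (∀ z, B z = if 0 < z.im then KZ.of (ρ z) else if z.im < 0 then -KZ.of (ρ ((starRingEnd ℂ) z)) else 0) →
    ∀ x y : ℂ, IsAlgebraic ℚ x →
    x ≠ 0 → x ≠ 1 → y ≠ 0 → y ≠ 1 → x ≠ y →
    B x - B y + B (y / x) - B ((1 - x⁻¹) / (1 - y⁻¹)) + B ((1 - x) / (1 - y)) ∈ relations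

/-- **Algebraicity of `y` is load-bearing.** Witness `x = −1`, `y = L + i` (transcendental),
`ρ = ρ₁`: `B x = 0`, `−B y` and `B (y/x) = B (−y)` each contribute `+vol T(i)` (junk `−R₀` on
the line `Im w = 1`), and the two remaining terms contribute positive volumes whatever the
algebraicity status of their arguments (`Im ≠ 1` there since `L ∉ {0, 2}`): value `> 0`. [folklore] -/
theorem fiveTermTransfer_false_without_algY : ¬ FiveTermTransferWithoutAlgY := by
  intro h
  have hmem := h idealTetrahedron (fun _ => rfl) ρ₁ (isStandardOn_stdRep J₁) (signedClass ρ₁)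
    (fun _ => rfl) (-1) xL (isAlgebraic_of_eq_rat (-1) 0 (by push_cast; ring)) (by norm_num)
    (by norm_num) xL_ne_zero xL_ne_one (by intro e; simpa using congrArg Complex.im e)
  change fiveTerm (signedClass ρ₁) (-1) xL ∈ relations at hmem
  have hN : 0 < (L - 1) * (L - 1) + 1 := add_pos_of_nonneg_of_pos (mul_self_nonneg _) one_pos
  -- third argument `y / x = -y`
  have e3 : xL / (-1) = -xL := by rw [div_neg, div_one]
  have him3 : (-xL).im < 0 := by simp
  have hc3 : (conj (-xL)).im = 1 := by simp
  have halg3 : ¬ IsAlgebraic ℚ (conj (-xL)) := fun h3 => not_isAlgebraic_xL (by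
    have h3' := (h3.algHom (starRingEnd ℂ).toRatAlgHom).neg
    simpa using h3')
  -- fourth argument `2 / (1 - y⁻¹) = 2y / (y - 1)`
  have hxL1 : xL - 1 ≠ 0 := sub_ne_zero.mpr xL_ne_one
  have hinv1 : (1 : ℂ) - xL⁻¹ ≠ 0 := by
    rw [sub_ne_zero, ne_comm, ne_eq, inv_eq_one]
    exact xL_ne_one
  have e4 : (1 - (-1:ℂ)⁻¹) / (1 - xL⁻¹) = 2 * xL / (xL - 1) := by
    rw [inv_neg, inv_one, sub_neg_eq_add, one_add_one_eq_two, div_eq_div_iff hinv1 hxL1, mul_sub,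
      mul_sub, mul_one, mul_assoc (2:ℂ) xL xL⁻¹, mul_inv_cancel₀ xL_ne_zero]
    ring
  have normSq4 : Complex.normSq (xL - 1) = (L - 1) * (L - 1) + 1 := by
    simp [Complex.normSq_apply, xL]
  have him4 : (2 * xL / (xL - 1)).im = -(2 / ((L - 1) * (L - 1) + 1)) := by
    rw [Complex.div_im, normSq4]
    simp [xL]
    field_simp
    ring
  have him4' : (conj (2 * xL / (xL - 1))).im ≠ 1 := by
    rw [Complex.conj_im, him4, neg_neg]
    intro e
    apply normSq_xL_sub_one_ne_two
    field_simp at e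
    linarith
  -- fifth argument `2 / (1 - y)`
  have e5 : (1 - (-1:ℂ)) / (1 - xL) = 2 / (1 - xL) := by
    rw [sub_neg_eq_add, one_add_one_eq_two]
  have normSq5 : Complex.normSq (1 - xL) = (L - 1) * (L - 1) + 1 := by
    simp [Complex.normSq_apply, xL]
    ring
  have him5 : ((2:ℂ) / (1 - xL)).im = 2 / ((L - 1) * (L - 1) + 1) := by
    rw [Complex.div_im, normSq5]
    simp [xL, neg_div]
  have him5' : ((2:ℂ) / (1 - xL)).im ≠ 1 := by
    rw [him5]
    intro e
    apply normSq_xL_sub_one_ne_two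
    field_simp at e
    linarith
  -- evaluate
  have key : eval (fiveTerm (signedClass ρ₁) (-1) xL) =
      R₀.value + R₀.value + (ρ₁ (conj (2 * xL / (xL - 1)))).value + (ρ₁ (2 / (1 - xL))).value := by
    unfold fiveTerm
    rw [e3, e4, e5, signedClass_of_im_zero ρ₁ (z := -1) (by simp),
      signedClass_of_im_pos ρ₁ (z := xL) (by simp), signedClass_of_im_neg ρ₁ him3,
      signedClass_of_im_neg ρ₁ (z := 2 * xL / (xL - 1))
        (by rw [him4]; exact neg_neg_of_pos (div_pos two_pos hN)),
      signedClass_of_im_pos ρ₁ (z := 2 / (1 - xL)) (by rw [him5]; exact div_pos two_pos hN),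
      ρ₁_eq_neg not_isAlgebraic_xL xL_im, ρ₁_eq_neg halg3 hc3]
    simp only [map_add, map_sub, map_neg, eval_of, IntegralRep.value_neg, zero_sub]
    ring
  refine not_mem_relations_of_eval_ne_zero (ne_of_gt ?_) hmem
  rw [key]
  linarith [R₀_value_pos, value_ρ₁_pos_of_im_ne_one him4', value_ρ₁_pos_of_im_ne_one him5']


end Summit.KontsevichZagierPeriods.HyperbolicBloch.FiveTermTransferNegative
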